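import Mathlib
import HarnessLib
import Summits.Ventures.LatticeQCDFlow.Scoring.DoeblinThinning
import Summits.Ventures.LatticeQCDFlow.Scoring.ReplicaChains
import Summits.Ventures.LatticeQCDFlow.Scoring.FlowSamplerAutocorrelation

/-!
# The exact flow sampler run in parallel and thinned — UNCONDITIONAL on `SU(n)^E`: `k` flow-MCMC
# updates per record carry the certificate `1 − (1 − e^{−2δ})^k`, and `R` independent streams divide
# the fluctuation term of the mean-square error but not the burn-in bias

HONEST FRAMING: exact (Metropolis-corrected) sampling algorithms for lattice gauge theory;
figures of merit are autocorrelation/cost numbers at stated couplings and volumes; no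
continuum-physics claim.

Venture `LatticeQCDFlow` (cell pub-lqcd), topic `Scoring`; FANOUT row 8 (`s0-cpn-nemc`, GEN-14).
NEW WORK of the cell, not a published result; no definition is introduced.  The composition of
`Scoring/DoeblinThinning.lean` (`doeblin_nHit_of_doeblin`, `thinnedChain_mse_le_of_doeblin`,
`thinnedChain_confidence_of_doeblin`) and `Scoring/ReplicaChains.lean`
(`replicaChains_mse_le_of_doeblin`, `replicaChains_median_confidence_of_doeblin`) with the tree's
exact flow-MCMC theorem `Exactness.flowSampler_exact_doeblin` (row 30 / lean-2, UNCONDITIONAL via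
`jacobianFormula_holds`: Doeblin constant `e^{−2δ}` from a uniform defect `δ` of Lüscher's flow
equation).  This is how flow samplers are actually run — batched independent streams on an
accelerator, several proposals per stored configuration.  Nothing is cited as a fact.

## Content (hypotheses of `Scoring.flowSampler_autocorrelation`; `K = indepMH q w` EXACT for
## `π = 𝒵⁻¹e^{−S}D[U]`; `|f| ≤ C`, `C' = C + |πf|`, `Var_π f = ∫ (f − πf)² dπ`)

* **`flowSampler_thinned`** — for every `k ≥ 1`: `Kᵏ(U, ·) ≥ (1 − (1 − e^{−2δ})^k) π` for every
  `U`, and for the sampler recording every `k`-th flow-MCMC state (kernel `nHit K k`), from ANY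
  initial law, every `m ≥ 1`, `0 < η ≤ 1`, with `ε_k = 1 − (1 − e^{−2δ})^k`:
  `E[((1/m) Σ_{i<m} f(U_i) − πf)²] ≤ (2/ε_k − 1) Var_π f/m + 16 C'²/(ε_k² m²)` and
  `P(|(1/m) Σ_{i<m} f(U_i) − πf| > 4C'/(ε_k m) + √(8 C'² log(2/η)/(ε_k² m))) ≤ η`;
* **`flowSampler_replicas`** — for `R ≥ 1` pairwise independent streams of length `N ≥ 1` with
  arbitrary initial laws, on any probability space carrying them:
  `E[(grand mean − πf)²] ≤ ((2e^{2δ} − 1) Var_π f/N + 16 C'² e^{4δ}/N²)/R + (1 − 1/R)(2C' e^{2δ}/N)²`,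
  and for mutually independent streams with `4((2e^{2δ} − 1) Var_π f/N + 16 C'² e^{4δ}/N²) ≤ s²`:
  `P(#{r < R : s ≤ |Y_r − πf|} ≥ R/2) ≤ e^{−R/8}` (`Y_r` the stream time averages; their median is
  then within `s` of `πf`).

Reading (value-free): a certified defect `δ` prices the two knobs of a production flow-sampler run
— proposals per stored configuration and number of streams — from a cold start: `k` updates per
record move every certificate from `e^{−2δ}` towards the independent sampler's `1` geometrically
(`ε_k ≥ 1 − exp(−k e^{−2δ})`), and `R` streams buy `1/R` on the fluctuation only, the squared
burn-in bias `(2C'e^{2δ}/N)²` keeping the weight `1 − 1/R`.  NOT CLAIMED: any value of `δ`; that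
the recorded states of ONE stream thinned by `k` have the path law of the `Kᵏ`-chain (modelled, as
in `Scoring/DoeblinThinning.lean`); unbounded observables.
-/

noncomputable section

namespace Summit.Ventures.LatticeQCDFlow.Scoring

open MeasureTheory ProbabilityTheory Filter Finset Summit.Ventures.LatticeQCDFlow.Exactness
open Literature.MathematicalPhysics.QuantumFieldTheory
open Literature.MathematicalPhysics.QuantumFieldTheory.Luscher2010
open Summit.Ventures.LatticeQCDFlow.TrivializingMaps
open scoped ENNReal Matrix Matrix.Norms.Frobenius ContDiff

variable {d L n : ℕ} [NeZero L]

/-- **`k` flow-MCMC updates per recorded configuration — UNCONDITIONAL, any start.**  See the module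
docstring. -/
theorem flowSampler_thinned (B : SuBasis n)
    {S : AmbConfig d L n → ℝ} (hS : ContDiff ℝ ∞ S) {F : ℝ → AmbConfig d L n → ℝ}
    (hF : ContDiff ℝ ∞ fun p : ℝ × AmbConfig d L n => F p.1 p.2)
    {Φ : ℝ → GaugeConfig d L (Matrix.specialUnitaryGroup (Fin n) ℂ) →
      GaugeConfig d L (Matrix.specialUnitaryGroup (Fin n) ℂ)}
    (hΦ : IsFlowMap (fun t W => -linkGrad B (F t) W) Φ) {c : ℝ → ℝ} {δ : ℝ}
    (hδ : ∀ t ∈ Set.Icc (0 : ℝ) 1, ∀ U : GaugeConfig d L (Matrix.specialUnitaryGroup (Fin n) ℂ),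
      |luscherL B S t (F t) (WilsonFlow.coeConfig U) - S (WilsonFlow.coeConfig U) - c t| ≤ δ)
    (q : Measure (GaugeConfig d L (Matrix.specialUnitaryGroup (Fin n) ℂ))) [IsProbabilityMeasure q]
    (hq : q = Measure.map (Φ 1) (trivialMeasure (Matrix.specialUnitaryGroup (Fin n) ℂ) d L)) :
    ∃ w : GaugeConfig d L (Matrix.specialUnitaryGroup (Fin n) ℂ) → ℝ, ∃ hw : Measurable w,
      (q.withDensity fun U => ENNReal.ofReal (w U)) =
        boltzmannMeasure (fun U : GaugeConfig d L (Matrix.specialUnitaryGroup (Fin n) ℂ) =>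
          S (WilsonFlow.coeConfig U)) ∧
      Kernel.Invariant (indepMH q w)
        (boltzmannMeasure fun U : GaugeConfig d L (Matrix.specialUnitaryGroup (Fin n) ℂ) =>
          S (WilsonFlow.coeConfig U)) ∧
      ∀ k : ℕ, k ≠ 0 →
        let π := boltzmannMeasure fun U : GaugeConfig d L (Matrix.specialUnitaryGroup (Fin n) ℂ) =>
          S (WilsonFlow.coeConfig U)
        haveI : Fact (Measurable w) := ⟨hw⟩
        (∀ (U : GaugeConfig d L (Matrix.specialUnitaryGroup (Fin n) ℂ))
            {A : Set (GaugeConfig d L (Matrix.specialUnitaryGroup (Fin n) ℂ))}, MeasurableSet A →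
            ENNReal.ofReal (1 - (1 - Real.exp (-(2 * δ))) ^ k) * π A ≤ nHit (indepMH q w) k U A) ∧
        ∀ (μ₀ : Measure (GaugeConfig d L (Matrix.specialUnitaryGroup (Fin n) ℂ))) [IsProbabilityMeasure μ₀]
          (f : GaugeConfig d L (Matrix.specialUnitaryGroup (Fin n) ℂ) → ℝ), Measurable f →
          ∀ C : ℝ, (∀ U, |f U| ≤ C) → ∀ m : ℕ, m ≠ 0 →
          haveI := isMarkovKernel_nHit (indepMH q w) k
          let Pk := Kernel.trajMeasure
            (X := fun _ : ℕ => GaugeConfig d L (Matrix.specialUnitaryGroup (Fin n) ℂ)) μ₀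
            (fun j : ℕ => (nHit (indepMH q w) k).comap
              (fun y : (i : ↥(Finset.Iic j)) → GaugeConfig d L (Matrix.specialUnitaryGroup (Fin n) ℂ) =>
                y ⟨j, Finset.mem_Iic.2 le_rfl⟩) (measurable_pi_apply _))
          ∫ x, ((∑ i ∈ Finset.range m, f (x i)) / m - ∫ V, f V ∂π) ^ 2 ∂Pk
              ≤ (2 / (1 - (1 - Real.exp (-(2 * δ))) ^ k) - 1) * (∫ V, (f V - ∫ V', f V' ∂π) ^ 2 ∂π) / m
                + 16 * (C + |∫ V, f V ∂π|) ^ 2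
                  / ((1 - (1 - Real.exp (-(2 * δ))) ^ k) ^ 2 * (m : ℝ) ^ 2) ∧
            ∀ η : ℝ, 0 < η → η ≤ 1 →
              Pk.real {x | 4 * (C + |∫ V, f V ∂π|) / ((1 - (1 - Real.exp (-(2 * δ))) ^ k) * m)
                    + Real.sqrt (8 * (C + |∫ V, f V ∂π|) ^ 2 * Real.log (2 / η)
                        / ((1 - (1 - Real.exp (-(2 * δ))) ^ k) ^ 2 * m))
                  < |(∑ i ∈ Finset.range m, f (x i)) / m - ∫ V, f V ∂π|} ≤ η := by
  obtain ⟨w, hw, -, -, hπ, hinv, -, hdoeb⟩ := flowSampler_exact_doeblin B hS hF hΦ hδ q hq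
  haveI : Fact (Measurable w) := ⟨hw⟩
  have hS'c : Continuous fun U : GaugeConfig d L (Matrix.specialUnitaryGroup (Fin n) ℂ) =>
      S (WilsonFlow.coeConfig U) := hS.continuous.comp WilsonFlow.continuous_coeConfig
  haveI := isProbabilityMeasure_boltzmannMeasure (d := d) (L := L) hS'c
  have hε0 : 0 < ENNReal.ofReal (Real.exp (-(2 * δ))) := ENNReal.ofReal_pos.2 (Real.exp_pos _)
  have hr : (ENNReal.ofReal (Real.exp (-(2 * δ)))).toReal = Real.exp (-(2 * δ)) :=
    ENNReal.toReal_ofReal (Real.exp_pos _).le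
  refine ⟨w, hw, hπ, hinv, fun k hk => ⟨fun U A hA => ?_, fun μ₀ _ f hf C hC m hm => ⟨?_, ?_⟩⟩⟩
  · exact doeblin_nHit_of_doeblin_exp (κ := indepMH q w) hinv (fun x B hB => hdoeb x hB) k U hA
  · have h := thinnedChain_mse_le_of_doeblin (κ := indepMH q w) (μ₀ := μ₀) hinv
      (fun x B hB => hdoeb x hB) hε0 hk hf hC hm
    rw [hr] at h
    exact h
  · intro η hη0 hη1
    have h := thinnedChain_confidence_of_doeblin (κ := indepMH q w) (μ₀ := μ₀) hinv
      (fun x B hB => hdoeb x hB) hε0 hk hf hC hm hη0 hη1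
    rw [hr] at h
    exact h

/-- **`R` independent flow-sampler streams — UNCONDITIONAL, arbitrary starts.**  See the module
docstring. -/
theorem flowSampler_replicas (B : SuBasis n)
    {S : AmbConfig d L n → ℝ} (hS : ContDiff ℝ ∞ S) {F : ℝ → AmbConfig d L n → ℝ}
    (hF : ContDiff ℝ ∞ fun p : ℝ × AmbConfig d L n => F p.1 p.2)
    {Φ : ℝ → GaugeConfig d L (Matrix.specialUnitaryGroup (Fin n) ℂ) →
      GaugeConfig d L (Matrix.specialUnitaryGroup (Fin n) ℂ)}
    (hΦ : IsFlowMap (fun t W => -linkGrad B (F t) W) Φ) {c : ℝ → ℝ} {δ : ℝ}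
    (hδ : ∀ t ∈ Set.Icc (0 : ℝ) 1, ∀ U : GaugeConfig d L (Matrix.specialUnitaryGroup (Fin n) ℂ),
      |luscherL B S t (F t) (WilsonFlow.coeConfig U) - S (WilsonFlow.coeConfig U) - c t| ≤ δ)
    (q : Measure (GaugeConfig d L (Matrix.specialUnitaryGroup (Fin n) ℂ))) [IsProbabilityMeasure q]
    (hq : q = Measure.map (Φ 1) (trivialMeasure (Matrix.specialUnitaryGroup (Fin n) ℂ) d L)) :
    ∃ w : GaugeConfig d L (Matrix.specialUnitaryGroup (Fin n) ℂ) → ℝ, ∃ hw : Measurable w,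
      (q.withDensity fun U => ENNReal.ofReal (w U)) =
        boltzmannMeasure (fun U : GaugeConfig d L (Matrix.specialUnitaryGroup (Fin n) ℂ) =>
          S (WilsonFlow.coeConfig U)) ∧
      Kernel.Invariant (indepMH q w)
        (boltzmannMeasure fun U : GaugeConfig d L (Matrix.specialUnitaryGroup (Fin n) ℂ) =>
          S (WilsonFlow.coeConfig U)) ∧
      ∀ {Ω' : Type*} [MeasurableSpace Ω'] (μ : Measure Ω') [IsProbabilityMeasure μ]
        (X : ℕ → Ω' → (ℕ → GaugeConfig d L (Matrix.specialUnitaryGroup (Fin n) ℂ)))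
        (μ₀ : ℕ → Measure (GaugeConfig d L (Matrix.specialUnitaryGroup (Fin n) ℂ)))
        [∀ r, IsProbabilityMeasure (μ₀ r)] (R : ℕ), R ≠ 0 → (∀ r, Measurable (X r)) →
        haveI : Fact (Measurable w) := ⟨hw⟩
        (∀ r < R, μ.map (X r) = Kernel.trajMeasure
            (X := fun _ : ℕ => GaugeConfig d L (Matrix.specialUnitaryGroup (Fin n) ℂ)) (μ₀ r)
            (fun j : ℕ => (indepMH q w).comap
              (fun y : (i : ↥(Finset.Iic j)) → GaugeConfig d L (Matrix.specialUnitaryGroup (Fin n) ℂ) =>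
                y ⟨j, Finset.mem_Iic.2 le_rfl⟩) (measurable_pi_apply _))) →
        ∀ (f : GaugeConfig d L (Matrix.specialUnitaryGroup (Fin n) ℂ) → ℝ), Measurable f →
          ∀ C : ℝ, (∀ U, |f U| ≤ C) → ∀ N : ℕ, N ≠ 0 →
          let π := boltzmannMeasure fun U : GaugeConfig d L (Matrix.specialUnitaryGroup (Fin n) ℂ) =>
            S (WilsonFlow.coeConfig U)
          ((∀ i < R, ∀ j < R, i ≠ j → IndepFun (X i) (X j) μ) →
            ∫ xs, (replicaMean (fun r xs => (∑ i ∈ Finset.range N, f (X r xs i)) / N) R xs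
                - ∫ V, f V ∂π) ^ 2 ∂μ
              ≤ ((2 * Real.exp (2 * δ) - 1) * (∫ V, (f V - ∫ V', f V' ∂π) ^ 2 ∂π) / N
                    + 16 * (C + |∫ V, f V ∂π|) ^ 2 * Real.exp (4 * δ) / (N : ℝ) ^ 2) / R
                + (1 - 1 / R) * (2 * (C + |∫ V, f V ∂π|) * Real.exp (2 * δ) / N) ^ 2) ∧
          (iIndepFun X μ → ∀ s : ℝ, 0 < s →
            4 * ((2 * Real.exp (2 * δ) - 1) * (∫ V, (f V - ∫ V', f V' ∂π) ^ 2 ∂π) / N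
              + 16 * (C + |∫ V, f V ∂π|) ^ 2 * Real.exp (4 * δ) / (N : ℝ) ^ 2) ≤ s ^ 2 →
            μ.real {xs | (R : ℝ) / 2 ≤ #{r ∈ range R |
                s ≤ |(∑ i ∈ Finset.range N, f (X r xs i)) / N - ∫ V, f V ∂π|}}
              ≤ Real.exp (-(R / 8))) := by
  obtain ⟨w, hw, -, -, hπ, hinv, -, hdoeb⟩ := flowSampler_exact_doeblin B hS hF hΦ hδ q hq
  haveI : Fact (Measurable w) := ⟨hw⟩
  have hS'c : Continuous fun U : GaugeConfig d L (Matrix.specialUnitaryGroup (Fin n) ℂ) =>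
      S (WilsonFlow.coeConfig U) := hS.continuous.comp WilsonFlow.continuous_coeConfig
  haveI := isProbabilityMeasure_boltzmannMeasure (d := d) (L := L) hS'c
  have hε0 : 0 < ENNReal.ofReal (Real.exp (-(2 * δ))) := ENNReal.ofReal_pos.2 (Real.exp_pos _)
  have hr : (ENNReal.ofReal (Real.exp (-(2 * δ)))).toReal = Real.exp (-(2 * δ)) :=
    ENNReal.toReal_ofReal (Real.exp_pos _).le
  refine ⟨w, hw, hπ, hinv, fun μ _ X μ₀ _ R hR hXm hlaw f hf C hC N hN => ⟨fun hind => ?_,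
    fun hind s hs hs2 => ?_⟩⟩
  all_goals set Cp := C + |∫ V, f V ∂(boltzmannMeasure fun U : GaugeConfig d L
        (Matrix.specialUnitaryGroup (Fin n) ℂ) => S (WilsonFlow.coeConfig U))| with hCp
  all_goals have he2 : Real.exp (2 * δ) = (Real.exp (-(2 * δ)))⁻¹ := by rw [Real.exp_neg, inv_inv]
  all_goals have h4 : Real.exp (4 * δ) = Real.exp (2 * δ) ^ 2 := by rw [← Real.exp_nat_mul]; ring_nf
  all_goals have hene : Real.exp (-(2 * δ)) ≠ 0 := (Real.exp_pos _).ne'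
  all_goals have hNne : (N : ℝ) ≠ 0 := by exact_mod_cast hN
  · have h := replicaChains_mse_le_of_doeblin (κ := indepMH q w) (μ := μ) (X := X) (μ₀ := μ₀)
      hinv (fun x B hB => hdoeb x hB) hε0 hf hC hN hR hXm hlaw hind
    rw [hr] at h
    refine h.trans (le_of_eq ?_)
    rw [h4, he2]
    field_simp
    ring
  · have hs2' : 4 * ((2 / (ENNReal.ofReal (Real.exp (-(2 * δ)))).toReal - 1)
        * (∫ V, (f V - ∫ V', f V' ∂(boltzmannMeasure fun U : GaugeConfig d L
            (Matrix.specialUnitaryGroup (Fin n) ℂ) => S (WilsonFlow.coeConfig U))) ^ 2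
            ∂(boltzmannMeasure fun U : GaugeConfig d L (Matrix.specialUnitaryGroup (Fin n) ℂ) =>
              S (WilsonFlow.coeConfig U))) / N
        + 16 * Cp ^ 2 / ((ENNReal.ofReal (Real.exp (-(2 * δ)))).toReal ^ 2 * (N : ℝ) ^ 2))
        ≤ s ^ 2 := by
      rw [hr]
      refine le_of_eq_of_le ?_ hs2
      rw [h4, he2]
      field_simp
    exact replicaChains_median_confidence_of_doeblin (κ := indepMH q w) (μ := μ) (X := X)
      (μ₀ := μ₀) hinv (fun x B hB => hdoeb x hB) hε0 hf hC hN hXm hlaw hind hs hs2'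

end Summit.Ventures.LatticeQCDFlow.Scoring

end
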